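import Literature.Analysis.FluidPDE.ClassicalSpeedBoundIncrements
import Literature.Analysis.FluidPDE.NSLerayHopfSereginProofs
import HarnessLib

/-!
# Crux `NearExtremalTransiencePerFlow` (stmt-NavierStokesRegularity-26567) — window-interior gradient bound by parabolic smoothing
# off the height bound (idea-crit-4 g9, N2 of the verdict on LINE g12-β «depleted_fraction», 2026-08-29T12:45Z)

`--supports stmt-NavierStokesRegularity-26567` (helper; prover seat ns-net-p2 g12).  The heart X♭ `DepletedFraction`
(`Theorems/ExtremiserTransienceDepletedFractionDefs.lean`) assumes a gradient bound only AT the start `t` of the admissible window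
`I = [t, t + τ₁ν/M²]` and a HEIGHT bound `‖u(t')‖_∞ ≤ H M` on `I`; the compactness step C♭ of the idea
`Ideas/nondegenerate-extremal-curve.md` (relay exclusion) needs a gradient bound in the INTERIOR of the window.  This file supplies it:

* `exists_window_norm_fderiv_le` — KNSS 2009 (4.10) on a WINDOW: for every delay `d > 0` there is `C = C(d)` such that a classical
  solution on `[0,T) × ℝ³` bounded by `G` on `[t₀, t₀ + τ] × ℝ³` (`t₀ + τ < T`), slices uniformly in `L²` there, has
  `‖∇u(t, x)‖ ≤ C G²/ν` for `t ∈ (t₀ + dν/G², t₀ + τ)`.  (The case `t₀ = 0` is the Literature theorem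
  `exists_norm_fderiv_le_of_speed_le_delay`; the proof is the same parabolic rescaling `u ↦ G⁻¹u(t₀ + νs/G², νy/G)` into the
  unit-viscosity unit-bound lemma `exists_norm_fderiv_le_of_classical_unit_delay`, now centred at `t₀`.)
* `exists_window_gradient_of_heights` — the X♭ vocabulary: for classical Leray–Hopf flows, heights `≤ H M` on
  `[t, t + τ₁ν/M²]` give `‖∇u(t', x)‖ ≤ C(d) (HM)²/ν` for `t' ∈ (t + dν/(HM)², t + τ₁ν/M²)` (the `L²` bound is the Leray–Hopf energy
  bound `eLpNorm_two_le_of_isLerayHopfOn`).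
HONEST FRAMING: a smoothing estimate for classical solutions; nothing about Navier–Stokes regularity, X♭ or ⟨26567⟩ is proved; no
summit is proved by a line.
[cite: KochNadirashviliSereginSverak2009, Prop. 4.1 and (4.10) (arXiv:0709.3599 §4)]
-/

noncomputable section

open scoped Topology ENNReal NNReal
open MeasureTheory Filter Set Function
open Literature.Analysis Literature.Analysis.FluidPDE

namespace Summit.NavierStokesRegularity.NavierStokesRegularity.Theorems.NearExtremalTransiencePerFlow.DepletedFraction

-- the summit's namespace repeats the problem name by convention (D-0017)
set_option linter.dupNamespace false
set_option linter.style.longLine false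

/-- **Gradient smoothing on a window, arbitrary delay** (KNSS 2009 (4.10), quantitative by scaling, centred at `t₀`): for every
`d > 0` there is `C = C(d)` such that for `ν > 0`, `G > 0`, every classical solution with viscosity `ν` on `ℝ³ × [0,T)` bounded by
`G` on `[t₀, t₀ + τ] × ℝ³` (`0 ≤ t₀`, `t₀ + τ < T`) with slices uniformly in `L²` there satisfies `‖∇u(t, x)‖ ≤ C G²/ν` for all `x`
and all `t ∈ (t₀ + dν/G², t₀ + τ)`. [cite: KochNadirashviliSereginSverak2009, Prop. 4.1 and (4.10) (arXiv:0709.3599 §4)] -/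
theorem exists_window_norm_fderiv_le {d : ℝ} (hd : 0 < d) :
    ∃ C : ℝ, ∀ {ν T G t₀ τ : ℝ} {u : ℝ → EuclideanSpace ℝ (Fin 3) → EuclideanSpace ℝ (Fin 3)}
      {p : ℝ → EuclideanSpace ℝ (Fin 3) → ℝ}, 0 < ν → 0 < G →
      IsClassicalNSSolutionOn (Ico 0 T) ν 0 u p → 0 ≤ t₀ → t₀ + τ < T →
      (∀ t ∈ Icc t₀ (t₀ + τ), ∀ x, ‖u t x‖ ≤ G) → ∀ {K : ℝ≥0∞}, K ≠ ∞ →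
      (∀ t ∈ Icc t₀ (t₀ + τ), eLpNorm (u t) 2 volume ≤ K) →
      ∀ t ∈ Ioo (t₀ + d * ν / G ^ 2) (t₀ + τ), ∀ x, ‖fderiv ℝ (u t) x‖ ≤ C * G ^ 2 / ν := by
  obtain ⟨C₁, hC₁⟩ := exists_norm_fderiv_le_of_classical_unit_delay hd
  refine ⟨C₁, ?_⟩
  intro ν T G t₀ τ u p hν hG hcl ht₀ hT hbd K hK hL2 t ht x
  set α : ℝ := G⁻¹ with hα
  set γ : ℝ := ν / G with hγ
  set β : ℝ := ν / G ^ 2 with hβ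
  have hαpos : 0 < α := by rw [hα]; positivity
  have hγpos : 0 < γ := by rw [hγ]; positivity
  have hβpos : 0 < β := by rw [hβ]; positivity
  have hβαγ : β = α * γ := by rw [hβ, hα, hγ]; field_simp
  have hdpos : 0 < d * ν / G ^ 2 := by positivity
  have hτpos : 0 < τ := by linarith [ht.1, ht.2]
  -- the parabolic rescaling centred at `t₀`
  have hcl' := (hcl.mono Ioo_subset_Ico_self (uniqueDiffOn_Ioo 0 T)).stRescale hαpos hγpos hβαγ t₀ 0
  have hν1 : α * ν / γ = 1 := by rw [hα, hγ]; field_simp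
  rw [hν1, smul_stPull_zero] at hcl'
  have hsub : Ioo 0 ((T - t₀) / β) ⊆ (fun r => t₀ + β * r) ⁻¹' Ioo 0 T := by
    intro r hr
    simp only [mem_preimage, mem_Ioo]
    refine ⟨by nlinarith [mul_pos hβpos hr.1], ?_⟩
    have h2 := hr.2
    rw [lt_div_iff₀ hβpos] at h2
    linarith
  have hcl'' := hcl'.mono hsub (uniqueDiffOn_Ioo 0 ((T - t₀) / β))
  set w : ℝ → EuclideanSpace ℝ (Fin 3) → EuclideanSpace ℝ (Fin 3) := α • stPull β γ t₀ 0 u with hw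
  have hwapp : ∀ s y, w s y = α • u (t₀ + β * s) (γ • y) := by
    intro s y
    simp only [hw, Pi.smul_apply, stPull_apply, zero_add]
  -- the rescaled window `(0, τ/β]`
  have hTw : 0 < τ / β := div_pos hτpos hβpos
  have hTwT : τ / β < (T - t₀) / β := div_lt_div_of_pos_right (by linarith) hβpos
  have hmemI : ∀ {s : ℝ}, s ∈ Ioc 0 (τ / β) → t₀ + β * s ∈ Icc t₀ (t₀ + τ) := by
    intro s hs
    refine ⟨by nlinarith [mul_pos hβpos hs.1], ?_⟩
    have := hs.2
    rw [le_div_iff₀' hβpos] at this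
    linarith
  have hbd' : ∀ s ∈ Ioc 0 (τ / β), ∀ y, ‖w s y‖ ≤ 1 := by
    intro s hs y
    rw [hwapp, norm_smul, Real.norm_of_nonneg hαpos.le, hα]
    have := hbd (t₀ + β * s) (hmemI hs) (γ • y)
    calc G⁻¹ * ‖u (t₀ + β * s) (γ • y)‖ ≤ G⁻¹ * G := by gcongr
      _ = 1 := inv_mul_cancel₀ hG.ne'
  set K' : ℝ≥0∞ := ENNReal.ofReal |α| * (ENNReal.ofReal (γ ^ 3)⁻¹) ^ (1 / 2 : ℝ) * K with hK'
  have hK'top : K' ≠ ∞ := by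
    refine ENNReal.mul_ne_top (ENNReal.mul_ne_top ENNReal.ofReal_ne_top ?_) hK
    exact ENNReal.rpow_ne_top_of_nonneg (by norm_num) ENNReal.ofReal_ne_top
  have hL2' : ∀ s ∈ Ioc 0 (τ / β), eLpNorm (w s) 2 volume ≤ K' := by
    intro s hs
    have h1 : w s = fun y => α • u (t₀ + β * s) ((0 : EuclideanSpace ℝ (Fin 3)) + γ • y) := by
      funext y; rw [hwapp, zero_add]
    rw [h1]
    refine (eLpNorm_two_smul_comp_affine_le α hγpos 0).trans ?_
    rw [hK']
    gcongr
    exact hL2 (t₀ + β * s) (hmemI hs)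
  -- the rescaled time `(t − t₀)/β` lies in the delayed window
  have htβ : (t - t₀) / β ∈ Ioo (0 + d) (τ / β) := by
    refine ⟨?_, div_lt_div_of_pos_right (by linarith [ht.2]) hβpos⟩
    rw [zero_add, lt_div_iff₀ hβpos, hβ]
    calc d * (ν / G ^ 2) = d * ν / G ^ 2 := by ring
      _ < t - t₀ := by linarith [ht.1]
  have key := hC₁ hcl'' hTw hTwT hbd' hK'top hL2' ((t - t₀) / β) htβ (γ⁻¹ • x)
  have hts : t₀ + β * ((t - t₀) / β) = t := by rw [mul_div_cancel₀ _ hβpos.ne']; ring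
  have htT : t ∈ Ico 0 T := ⟨by linarith [ht.1], by linarith [ht.2]⟩
  have hdiff : Differentiable ℝ (stPull β γ t₀ 0 u ((t - t₀) / β)) :=
    differentiable_stPull_slice (by
      rw [hts]; exact (hcl.contDiff_velocity htT).differentiable (by simp))
  have hD : fderiv ℝ (w ((t - t₀) / β)) (γ⁻¹ • x) = (α * γ) • fderiv ℝ (u t) x := by
    have h1 : w ((t - t₀) / β) = α • stPull β γ t₀ 0 u ((t - t₀) / β) := rfl
    rw [h1, fderiv_const_smul (hdiff _), fderiv_stPull, smul_smul]
    congr 2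
    · rw [hts]
    · rw [zero_add, smul_smul, mul_inv_cancel₀ hγpos.ne', one_smul]
  rw [hD, norm_smul, Real.norm_of_nonneg (by positivity)] at key
  have hαγ : α * γ = ν / G ^ 2 := by rw [hα, hγ]; field_simp
  rw [hαγ] at key
  have hG2 : 0 < G ^ 2 := by positivity
  have key' : ‖fderiv ℝ (u t) x‖ ≤ C₁ / (ν / G ^ 2) := by
    rw [le_div_iff₀ (div_pos hν hG2)]
    calc ‖fderiv ℝ (u t) x‖ * (ν / G ^ 2) = ν / G ^ 2 * ‖fderiv ℝ (u t) x‖ := mul_comm _ _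
      _ ≤ C₁ := key
  calc ‖fderiv ℝ (u t) x‖ ≤ C₁ / (ν / G ^ 2) := key'
    _ = C₁ * G ^ 2 / ν := by field_simp

/-- **Window-interior gradient bound from the height bound, X♭ vocabulary** (N2 of idea-crit-4 g9 on LINE g12-β): for every delay
`d > 0` there is `C = C(d) > 0` such that, for every classical Leray–Hopf flow on `[0,T) × ℝ³` and every window
`I = [t, t + τ₁ν/M²] ⊂ [0,T)` on which the heights stay `≤ H M`, the velocity GRADIENT obeys `‖∇u(t', x)‖ ≤ C (HM)²/ν` at every
`t' ∈ (t + dν/(HM)², t + τ₁ν/M²)` — i.e. the admissible-window gradient hypothesis of `DepletedFraction` propagates into the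
interior of the window (after a delay of `d/H²` turnover times) with constant `C(d) H²`.
[cite: KochNadirashviliSereginSverak2009, Prop. 4.1 and (4.10) (arXiv:0709.3599 §4)] -/
theorem exists_window_gradient_of_heights {d : ℝ} (hd : 0 < d) :
    ∃ C : ℝ, 0 < C ∧ ∀ (ν T : ℝ), 0 < ν → 0 < T →
    ∀ (u : ℝ → EuclideanSpace ℝ (Fin 3) → EuclideanSpace ℝ (Fin 3)) (p : ℝ → EuclideanSpace ℝ (Fin 3) → ℝ),
      IsClassicalNSSolutionOn (Set.Ico 0 T) ν 0 u p → IsLerayHopfOn T ν 0 (u 0) u →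
    ∀ (t M H τ₁ : ℝ), 0 ≤ t → 0 < M → 0 < H → t + τ₁ * ν / M ^ 2 < T →
      (∀ t' ∈ Set.Icc t (t + τ₁ * ν / M ^ 2), ∀ x, ‖u t' x‖ ≤ H * M) →
      ∀ t' ∈ Set.Ioo (t + d * ν / (H * M) ^ 2) (t + τ₁ * ν / M ^ 2), ∀ x,
        ‖fderiv ℝ (u t') x‖ ≤ C * (H * M) ^ 2 / ν := by
  obtain ⟨C₀, hC₀⟩ := exists_window_norm_fderiv_le hd
  refine ⟨max C₀ 1, lt_of_lt_of_le one_pos (le_max_right _ _), ?_⟩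
  intro ν T hν hT u p hsol hLH t M H τ₁ ht hM hH htT hheights t' ht' x
  set K : ℝ≥0∞ := ENNReal.ofReal (2 * VectorCalculus.kineticEnergy (u 0)) ^ (2⁻¹ : ℝ) with hK
  have hKtop : K ≠ ⊤ := ENNReal.rpow_ne_top_of_nonneg (by norm_num : (0:ℝ) ≤ 2⁻¹) ENNReal.ofReal_ne_top
  have hL2 : ∀ s ∈ Icc t (t + τ₁ * ν / M ^ 2), eLpNorm (u s) 2 volume ≤ K := fun s hs =>
    eLpNorm_two_le_of_isLerayHopfOn hν.le hLH ⟨ht.trans hs.1, hs.2.trans htT.le⟩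
  have hG : 0 < H * M := mul_pos hH hM
  have h := hC₀ hν hG hsol ht htT hheights hKtop hL2 t' ht' x
  refine h.trans ?_
  exact div_le_div_of_nonneg_right (mul_le_mul_of_nonneg_right (le_max_left _ _) (by positivity)) hν.le

end Summit.NavierStokesRegularity.NavierStokesRegularity.Theorems.NearExtremalTransiencePerFlow.DepletedFraction

end
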